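import Mathlib
import HarnessLib
import Summits.Ventures.LatticeQCDFlow.Scoring.DoeblinSkeleton
import Summits.Ventures.LatticeQCDFlow.Scaling.TunnellingLaws

/-!
# The autocovariance of a rarely-changing observable is LIPSCHITZ IN THE LAG: for ANY Markov kernel
# with `π` invariant, `|g| ≤ B`, `(π ⊗ₘ κ){g x ≠ g y} ≤ p` ⇒ `|C_g(t+1) − C_g(t)| ≤ 2B²p` for every `t`,
# hence `|C_g(t) − C_g(s)| ≤ 2B²p·|t − s|` — no fast decorrelation AND no fast recorrelation

HONEST FRAMING: exact (Metropolis-corrected) sampling algorithms for lattice gauge theory;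
figures of merit are autocorrelation/cost numbers at stated couplings and volumes; no
continuum-physics claim.

Venture `LatticeQCDFlow` (cell pub-lqcd), topic `Scoring`; FANOUT row 8 (`s0-cpn-nemc`, GEN-23).
NEW WORK of the cell, not a published result; no definition is introduced; nothing is cited as a
fact.  `Scoring/RareChangeAutocorrelation` (this row, GEN-23) proved the ONE-SIDED law
`C_g(t) ≥ ∫g² dπ − 2B²tp` from a stationary one-step change probability `(π ⊗ₘ κ){g x ≠ g y} ≤ p`
(`|g| ≤ B`; e.g. theory-2's tunnelling law for the topological charge).  THIS FILE proves the TWO-SIDED,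
LOCAL-IN-THE-LAG version by a different route (the operator form instead of the `t`-step change set):
(1) `∫ |kop κ g − g| dπ ≤ 2B·(π ⊗ₘ κ){g ≠ g'}` (Fubini; no invariance): one application of the kernel
moves a rarely-changing observable by little in `L¹(π)`;
(2) `|∫ f · kop K h dπ| ≤ B_f ∫ |h| dπ` for any Markov `K` with `π` invariant (`|f| ≤ B_f`);
(3) since `C_g(t+1) − C_g(t) = ∫ g · kop κᵗ (kop κ g − g) dπ` (`κᵗ = Exactness.nHit κ t`,
`Scoring/DoeblinSkeleton.kop_nHit`): **`|C_g(t+1) − C_g(t)| ≤ 2B²p`** for every `t`, and by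
telescoping **`|C_g(t) − C_g(s)| ≤ 2B²p|t − s|`**: the autocovariance FUNCTION of a frozen observable
is slowly varying — it can neither drop (freezing, the one-sided law again: `C(t) ≥ C(0) − 2B²tp`) nor
RISE by more than `2B²p` per lag (`C(t) ≤ C(s) + 2B²p(t − s)`: a non-reversible sampler cannot
re-correlate a frozen charge quickly either; oscillating autocorrelations of lifted / non-reversible
updates are confined to slope `2B²p`);
(4) the typed instance in theory-2's setting (`Scaling/TunnellingLaws`: `S` separating the charge `Q`
along the a.s.-allowed move relation, `π` invariant): `|C_{φ∘Q}(t+1) − C_{φ∘Q}(t)| ≤ 4B²π(S)`.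
Companions: `Scoring/RareChangeAutocorrelation` (one-sided law, windows), `Scoring/SectorLinearLaw`
(sector indicators).  Printed counterparts NAMED ONLY: none needed (elementary).

## Content (`κ` Markov; `π` a probability law; `|g| ≤ B` measurable; `D = {q | g q.1 ≠ g q.2}`)

* **`integral_abs_kop_sub_self_le_of_changeProb`** — (1): `∫ |kop κ g − g| dπ ≤ 2B p` if
  `(π ⊗ₘ κ)(D) ≤ ENNReal.ofReal p`;
* **`abs_integral_mul_kop_le`** — (2);
* **`autocov_succ_sub_eq`** — `C(t+1) − C(t) = ∫ g · kop (nHit κ t) (kop κ g − g) dπ`;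
* **`abs_autocov_succ_sub_le_of_changeProb`**, **`abs_autocov_sub_le_of_changeProb`** — (3);
  `autocov_le_add_of_changeProb` (`C(t) ≤ C(s) + 2B²p(t−s)`, `s ≤ t`),
  `autocov_zero_sub_le_of_changeProb` (`C(0) − C(t) ≤ 2B²pt`);
* **`abs_autocov_succ_sub_le_of_separating`** — (4).

NOT CLAIMED: anything about the sign of `C_g(t)`; the size of `p`; any number of ours.
-/

noncomputable section

namespace Summit.Ventures.LatticeQCDFlow.Scoring

open MeasureTheory ProbabilityTheory Filter Finset Summit.Ventures.LatticeQCDFlow.Exactness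
open scoped ENNReal

variable {Ω : Type*} [MeasurableSpace Ω]

/-! ### §1 One kernel step moves a rarely-changing observable by little in `L¹(π)` -/

section OneStep

variable (κ : Kernel Ω Ω) [IsMarkovKernel κ] (π : Measure Ω) [IsProbabilityMeasure π]

/-- **`∫ |kop κ g − g| dπ ≤ 2B·p`** if `|g| ≤ B` is measurable and `(π ⊗ₘ κ){g x ≠ g y} ≤ ENNReal.ofReal p`
(`0 ≤ p`); no invariance needed. -/
theorem integral_abs_kop_sub_self_le_of_changeProb {g : Ω → ℝ} (hg : Measurable g) {B : ℝ}
    (hB : ∀ x, |g x| ≤ B) {p : ℝ} (hp : 0 ≤ p)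
    (hchange : (π ⊗ₘ κ) {q : Ω × Ω | g q.1 ≠ g q.2} ≤ ENNReal.ofReal p) :
    ∫ x, |kop κ g x - g x| ∂π ≤ 2 * B * p := by
  have hB0 : 0 ≤ B := (abs_nonneg _).trans (hB (Classical.choice (nonempty_of_isProbabilityMeasure π)))
  -- pointwise: `|K g x − g x| ≤ ∫ |g y − g x| dκ(x)`
  have hpt : ∀ x, |kop κ g x - g x| ≤ ∫ y, |g y - g x| ∂(κ x) := by
    intro x
    have e : kop κ g x - g x = ∫ y, (g y - g x) ∂(κ x) := by
      unfold kop
      rw [integral_sub (integrable_of_bounded _ hg hB) (integrable_const _), integral_const,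
        probReal_univ, one_smul]
    rw [e]
    exact abs_integral_le_integral_abs
  have hφm : Measurable fun q : Ω × Ω => |g q.2 - g q.1| :=
    ((hg.comp measurable_snd).sub (hg.comp measurable_fst)).abs
  have hφb : ∀ q : Ω × Ω, |(|g q.2 - g q.1|)| ≤ B + B := fun q => by
    rw [abs_abs]; exact (abs_sub _ _).trans (add_le_add (hB _) (hB _))
  have hφi : Integrable (fun q : Ω × Ω => |g q.2 - g q.1|) (π ⊗ₘ κ) := integrable_of_bounded _ hφm hφb
  have hfub : ∫ x, ∫ y, |g y - g x| ∂(κ x) ∂π = ∫ q, |g q.2 - g q.1| ∂(π ⊗ₘ κ) :=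
    (Measure.integral_compProd hφi).symm
  set D : Set (Ω × Ω) := {q | g q.1 ≠ g q.2} with hD
  have hDm : MeasurableSet D := by
    have : D = {q : Ω × Ω | g q.1 = g q.2}ᶜ := by ext q; simp [hD]
    rw [this]
    exact (measurableSet_eq_fun (hg.comp measurable_fst) (hg.comp measurable_snd)).compl
  have hind : ∀ q : Ω × Ω, |g q.2 - g q.1| ≤ D.indicator (fun _ => 2 * B) q := by
    intro q
    by_cases hq : q ∈ D
    · rw [Set.indicator_of_mem hq]
      calc |g q.2 - g q.1| ≤ B + B := (abs_abs (g q.2 - g q.1)) ▸ hφb q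
        _ = 2 * B := by ring
    · have : g q.1 = g q.2 := by simpa [hD] using hq
      rw [Set.indicator_of_notMem hq, this, sub_self, abs_zero]
  have hDp : ((π ⊗ₘ κ) D).toReal ≤ p := ENNReal.toReal_le_of_le_ofReal hp hchange
  calc ∫ x, |kop κ g x - g x| ∂π ≤ ∫ x, ∫ y, |g y - g x| ∂(κ x) ∂π := by
        refine integral_mono_of_nonneg (ae_of_all _ fun x => abs_nonneg _) ?_ (ae_of_all _ hpt)
        rw [show (fun x => ∫ y, |g y - g x| ∂(κ x)) = fun x => ∫ y, (fun q : Ω × Ω => |g q.2 - g q.1|) (x, y) ∂(κ x)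
          from rfl]
        exact hφi.integral_compProd
    _ = ∫ q, |g q.2 - g q.1| ∂(π ⊗ₘ κ) := hfub
    _ ≤ ∫ q, D.indicator (fun _ => 2 * B) q ∂(π ⊗ₘ κ) :=
        integral_mono hφi ((integrable_const _).indicator hDm) hind
    _ = 2 * B * ((π ⊗ₘ κ) D).toReal := by
        rw [integral_indicator hDm, setIntegral_const, smul_eq_mul, mul_comm]; rfl
    _ ≤ 2 * B * p := mul_le_mul_of_nonneg_left hDp (by positivity)

end OneStep

/-! ### §2 The autocovariance increments -/

section Increments

variable {κ : Kernel Ω Ω} [IsMarkovKernel κ] {π : Measure Ω} [IsProbabilityMeasure π]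

/-- **`|∫ f · kop K h dπ| ≤ B_f ∫ |h| dπ`** for a Markov kernel `K` with `π` invariant, `|f| ≤ B_f`,
`h` bounded measurable. -/
theorem abs_integral_mul_kop_le (K : Kernel Ω Ω) [IsMarkovKernel K] (hπ : Kernel.Invariant K π)
    {f h : Ω → ℝ} (hf : Measurable f) {Bf : ℝ} (hBf : ∀ x, |f x| ≤ Bf) (hh : Measurable h) {Bh : ℝ}
    (hBh : ∀ x, |h x| ≤ Bh) :
    |∫ x, f x * kop K h x ∂π| ≤ Bf * ∫ x, |h x| ∂π := by
  have habs_m : Measurable fun x => |h x| := hh.abs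
  have habs_b : ∀ x, |(|h x|)| ≤ Bh := fun x => by rw [abs_abs]; exact hBh x
  -- `|K h x| ≤ K |h| x`
  have hpt : ∀ x, |f x * kop K h x| ≤ Bf * kop K (fun y => |h y|) x := by
    intro x
    rw [abs_mul]
    refine mul_le_mul (hBf x) ?_ (abs_nonneg _) ((abs_nonneg _).trans (hBf x))
    unfold kop
    exact abs_integral_le_integral_abs
  have hi1 : Integrable (fun x => f x * kop K h x) π :=
    integrable_of_bounded π (hf.mul (measurable_kop K hh)) (C := Bf * Bh) fun x => by
      rw [abs_mul]
      exact mul_le_mul (hBf x) (abs_kop_le K hBh x) (abs_nonneg _) ((abs_nonneg _).trans (hBf x))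
  have hi2 : Integrable (fun x => Bf * kop K (fun y => |h y|) x) π :=
    (integrable_of_bounded π (measurable_kop K habs_m) (abs_kop_le K habs_b)).const_mul Bf
  calc |∫ x, f x * kop K h x ∂π| ≤ ∫ x, |f x * kop K h x| ∂π := abs_integral_le_integral_abs
    _ ≤ ∫ x, Bf * kop K (fun y => |h y|) x ∂π := integral_mono hi1.abs hi2 hpt
    _ = Bf * ∫ x, |h x| ∂π := by rw [integral_const_mul, integral_kop K hπ habs_m habs_b]

/-- `kop K (u − v) = kop K u − kop K v` for bounded measurable `u, v`. -/
theorem kop_sub_apply (K : Kernel Ω Ω) [IsMarkovKernel K] {u v : Ω → ℝ} (hu : Measurable u) {Bu : ℝ}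
    (hBu : ∀ x, |u x| ≤ Bu) (hv : Measurable v) {Bv : ℝ} (hBv : ∀ x, |v x| ≤ Bv) (x : Ω) :
    kop K (fun y => u y - v y) x = kop K u x - kop K v x := by
  unfold kop
  exact integral_sub (integrable_of_bounded _ hu hBu) (integrable_of_bounded _ hv hBv)

/-- **`C_g(t+1) − C_g(t) = ∫ g · kop κᵗ (kop κ g − g) dπ`** (`κᵗ = nHit κ t`). -/
theorem autocov_succ_sub_eq {g : Ω → ℝ} (hg : Measurable g) {B : ℝ} (hB : ∀ x, |g x| ≤ B) (t : ℕ) :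
    autocov κ π g (t + 1) - autocov κ π g t
      = ∫ x, g x * kop (nHit κ t) (fun y => kop κ g y - g y) x ∂π := by
  haveI := isMarkovKernel_nHit κ t
  have hKg_m : Measurable (kop κ g) := measurable_kop κ hg
  have hKg_b : ∀ x, |kop κ g x| ≤ B := abs_kop_le κ hB
  have e1 : (kop κ)^[t + 1] g = kop (nHit κ t) (kop κ g) := by
    rw [Function.iterate_succ_apply, kop_nHit κ t hKg_m hKg_b]
  have e0 : (kop κ)^[t] g = kop (nHit κ t) g := (kop_nHit κ t hg hB).symm
  unfold autocov
  rw [e1, e0, ← integral_sub]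
  · refine integral_congr_ae (ae_of_all _ fun x => ?_)
    simp only [kop_sub_apply (nHit κ t) hKg_m hKg_b hg hB x]
    ring
  · exact integrable_of_bounded π (hg.mul (measurable_kop _ hKg_m)) (C := B * B) fun x => by
      rw [abs_mul]
      exact mul_le_mul (hB x) (abs_kop_le _ hKg_b x) (abs_nonneg _) ((abs_nonneg _).trans (hB x))
  · exact integrable_of_bounded π (hg.mul (measurable_kop _ hg)) (C := B * B) fun x => by
      rw [abs_mul]
      exact mul_le_mul (hB x) (abs_kop_le _ hB x) (abs_nonneg _) ((abs_nonneg _).trans (hB x))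

/-- **THE AUTOCOVARIANCE IS `2B²p`-LIPSCHITZ IN THE LAG**: `π` invariant, `|g| ≤ B` measurable,
`(π ⊗ₘ κ){g x ≠ g y} ≤ ENNReal.ofReal p`, `0 ≤ p` ⇒ `|C_g(t+1) − C_g(t)| ≤ 2B²p` for every `t`. -/
theorem abs_autocov_succ_sub_le_of_changeProb (hπ : Kernel.Invariant κ π) {g : Ω → ℝ}
    (hg : Measurable g) {B : ℝ} (hB : ∀ x, |g x| ≤ B) {p : ℝ} (hp : 0 ≤ p)
    (hchange : (π ⊗ₘ κ) {q : Ω × Ω | g q.1 ≠ g q.2} ≤ ENNReal.ofReal p) (t : ℕ) :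
    |autocov κ π g (t + 1) - autocov κ π g t| ≤ 2 * B ^ 2 * p := by
  haveI := isMarkovKernel_nHit κ t
  have hB0 : 0 ≤ B := (abs_nonneg _).trans (hB (Classical.choice (nonempty_of_isProbabilityMeasure π)))
  have hh_m : Measurable fun y => kop κ g y - g y := (measurable_kop κ hg).sub hg
  have hh_b : ∀ y, |kop κ g y - g y| ≤ B + B := fun y =>
    (abs_sub _ _).trans (add_le_add (abs_kop_le κ hB y) (hB y))
  rw [autocov_succ_sub_eq hg hB t]
  calc |∫ x, g x * kop (nHit κ t) (fun y => kop κ g y - g y) x ∂π|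
      ≤ B * ∫ x, |kop κ g x - g x| ∂π :=
        abs_integral_mul_kop_le (nHit κ t) (invariant_nHit hπ t) hg hB hh_m hh_b
    _ ≤ B * (2 * B * p) :=
        mul_le_mul_of_nonneg_left (integral_abs_kop_sub_self_le_of_changeProb κ π hg hB hp hchange) hB0
    _ = 2 * B ^ 2 * p := by ring

/-- **`|C_g(t) − C_g(s)| ≤ 2B²p·|t − s|`** (telescoping). -/
theorem abs_autocov_sub_le_of_changeProb (hπ : Kernel.Invariant κ π) {g : Ω → ℝ}
    (hg : Measurable g) {B : ℝ} (hB : ∀ x, |g x| ≤ B) {p : ℝ} (hp : 0 ≤ p)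
    (hchange : (π ⊗ₘ κ) {q : Ω × Ω | g q.1 ≠ g q.2} ≤ ENNReal.ofReal p) (s t : ℕ) :
    |autocov κ π g t - autocov κ π g s| ≤ 2 * B ^ 2 * p * (Nat.dist t s : ℝ) := by
  -- reduce to `s ≤ t` by symmetry, then induct on the gap
  have key : ∀ s k : ℕ, |autocov κ π g (s + k) - autocov κ π g s| ≤ 2 * B ^ 2 * p * k := by
    intro s k
    induction k with
    | zero => simp
    | succ k ih =>
      have hstep := abs_autocov_succ_sub_le_of_changeProb hπ hg hB hp hchange (s + k)
      calc |autocov κ π g (s + (k + 1)) - autocov κ π g s|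
          = |(autocov κ π g (s + k + 1) - autocov κ π g (s + k))
              + (autocov κ π g (s + k) - autocov κ π g s)| := by rw [← add_assoc]; ring_nf
        _ ≤ |autocov κ π g (s + k + 1) - autocov κ π g (s + k)|
              + |autocov κ π g (s + k) - autocov κ π g s| := abs_add_le _ _
        _ ≤ 2 * B ^ 2 * p + 2 * B ^ 2 * p * k := add_le_add hstep ih
        _ = 2 * B ^ 2 * p * (k + 1 : ℕ) := by push_cast; ring
  rcases le_total s t with hst | hts
  · obtain ⟨k, rfl⟩ := Nat.exists_eq_add_of_le hst
    rw [Nat.dist_comm, Nat.dist_eq_sub_of_le hst, Nat.add_sub_cancel_left]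
    exact key s k
  · obtain ⟨k, rfl⟩ := Nat.exists_eq_add_of_le hts
    rw [abs_sub_comm, Nat.dist_eq_sub_of_le hts, Nat.add_sub_cancel_left]
    exact key t k

/-- **NO FAST RECORRELATION**: `C_g(t) ≤ C_g(s) + 2B²p(t − s)` for `s ≤ t`. -/
theorem autocov_le_add_of_changeProb (hπ : Kernel.Invariant κ π) {g : Ω → ℝ}
    (hg : Measurable g) {B : ℝ} (hB : ∀ x, |g x| ≤ B) {p : ℝ} (hp : 0 ≤ p)
    (hchange : (π ⊗ₘ κ) {q : Ω × Ω | g q.1 ≠ g q.2} ≤ ENNReal.ofReal p) {s t : ℕ} (hst : s ≤ t) :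
    autocov κ π g t ≤ autocov κ π g s + 2 * B ^ 2 * p * ((t : ℝ) - s) := by
  have h := abs_autocov_sub_le_of_changeProb hπ hg hB hp hchange s t
  rw [Nat.dist_comm, Nat.dist_eq_sub_of_le hst, Nat.cast_sub hst] at h
  linarith [le_abs_self (autocov κ π g t - autocov κ π g s)]

/-- **NO FAST DECORRELATION** (the one-sided law of `Scoring/RareChangeAutocorrelation`, re-derived):
`C_g(0) − C_g(t) ≤ 2B²p·t`. -/
theorem autocov_zero_sub_le_of_changeProb (hπ : Kernel.Invariant κ π) {g : Ω → ℝ}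
    (hg : Measurable g) {B : ℝ} (hB : ∀ x, |g x| ≤ B) {p : ℝ} (hp : 0 ≤ p)
    (hchange : (π ⊗ₘ κ) {q : Ω × Ω | g q.1 ≠ g q.2} ≤ ENNReal.ofReal p) (t : ℕ) :
    autocov κ π g 0 - autocov κ π g t ≤ 2 * B ^ 2 * p * t := by
  have h := abs_autocov_sub_le_of_changeProb hπ hg hB hp hchange t 0
  simp only [Nat.dist_zero_left] at h
  linarith [le_abs_self (autocov κ π g 0 - autocov κ π g t)]

end Increments

/-! ### §3 The typed instance -/

section Separating

variable {κ : Kernel Ω Ω} [IsMarkovKernel κ] {π : Measure Ω} [IsProbabilityMeasure π]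
  {ι : Type*} {R : Ω → Ω → Prop} {Q : Ω → ι} {S : Set Ω} {φ : ι → ℝ}

/-- **IN THEORY-2'S SETTING** (`S` separates `Q` along the a.s.-allowed relation `R`, `π` invariant;
`|φ ∘ Q| ≤ B` measurable): `|C_{φ∘Q}(t+1) − C_{φ∘Q}(t)| ≤ 4B²π(S)` for every `t`. -/
theorem abs_autocov_succ_sub_le_of_separating (hS : ∀ ⦃x y⦄, R x y → Q x ≠ Q y → x ∈ S ∨ y ∈ S)
    (hπ : Kernel.Invariant κ π) (hR : ∀ᵐ q ∂(π ⊗ₘ κ), R q.1 q.2)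
    (hg : Measurable fun x => φ (Q x)) {B : ℝ} (hB : ∀ x, |φ (Q x)| ≤ B) (t : ℕ) :
    |autocov κ π (fun x => φ (Q x)) (t + 1) - autocov κ π (fun x => φ (Q x)) t|
      ≤ 4 * B ^ 2 * π.real S := by
  have hsub : {q : Ω × Ω | φ (Q q.1) ≠ φ (Q q.2)} ⊆ {q : Ω × Ω | Q q.1 ≠ Q q.2} := by
    intro q hq hQ
    exact hq (by rw [hQ])
  have hchange : (π ⊗ₘ κ) {q : Ω × Ω | φ (Q q.1) ≠ φ (Q q.2)} ≤ ENNReal.ofReal (2 * π.real S) := by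
    calc (π ⊗ₘ κ) {q : Ω × Ω | φ (Q q.1) ≠ φ (Q q.2)}
        ≤ (π ⊗ₘ κ) {q : Ω × Ω | Q q.1 ≠ Q q.2} := measure_mono hsub
      _ ≤ 2 * π S := Theory2.Tunnelling.compProd_chargeChange_le_of_invariant hS π κ hπ hR
      _ = ENNReal.ofReal (2 * π.real S) := by
          rw [ENNReal.ofReal_mul zero_le_two, ENNReal.ofReal_ofNat, ofReal_measureReal]
  have h := abs_autocov_succ_sub_le_of_changeProb hπ hg hB (by positivity) hchange t
  linarith

end Separating

end Summit.Ventures.LatticeQCDFlow.Scoring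

end
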